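import Literature.NumberTheory.Automorphic.UnitaryGroupTruncatedKernelOscillation
import Literature.NumberTheory.Automorphic.UnitaryGroupTruncatedKernelIntegrableOfCusp
import Literature.NumberTheory.Automorphic.TestFunctionLieDeriv
import Literature.NumberTheory.Automorphic.AutomorphicFormsL2Derivative
import Literature.NumberTheory.Automorphic.AutomorphicTwistHecke
import HarnessLib

/-!
# Test functions on `U(J₃)(𝔸_F)` lift to level-invariant functions on `GL₃(𝔸_E)` that are
# Lipschitz along the archimedean one-parameter elements (input H5c of the oscillation estimate)

Topic `NumberTheory/Automorphic`; namespace `Literature.NumberTheory.Automorphic`. Proof file: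
theorems only (no definition, no named fact, no instance, no `sorry`); imports = tree + Mathlib.

THE POINT (Rogawski (1990), §2.1–2.2; Borel–Jacquet (1979), §1.5, §4.1). The oscillation estimate
for Arthur's truncated kernel on `U(3)` (★ `UnitaryGroup.forall_norm_sub_conj_le_of_threeFactor`,
`UnitaryGroupTruncatedKernelOscillation`) consumes the test function `f ∈ C_c^∞(U(J₃)(𝔸_F))`
(`IsQuasiSplitTest`: `f = η₁ ∘ ι + i · η₂ ∘ ι` for Garrett test functions `η₁, η₂` on `GL₃(𝔸_E)`,
`ι = adelicVal`) only through three properties of a lift `φ = η₁ + iη₂` to `GL₃(𝔸_E)`: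
`f = φ ∘ adelicVal`; right invariance of `φ` under an admissible level `U`; and a Lipschitz bound
`‖φ (z · (exp (tX), 1)) − φ z‖ ≤ L|t|` along the archimedean one-parameter elements, uniformly in
`z ∈ GL₃(𝔸_E)` and in the direction `X` ranging over a compact set. The last is the mean value
theorem along `t ↦ exp (tX)` (★ `IsArchSmooth.norm_sub_le_of_lieDeriv_le`) fed with the uniform
bound on the first Lie derivatives of a smooth compactly supported kernel over a compact set of
directions (★ `IsSmoothKernelGL.exists_forall_norm_iterLieDeriv_ofFn_le` with one-letter words).

* §1 `IsSmoothKernelGL.exists_forall_norm_sub_expGL_le` — the Lipschitz bound for any smooth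
  kernel on `GL_n(𝔸_K)` (generic `n`, `K`), `IsTestFunctionGL.exists_forall_norm_sub_expGL_le`.
* §2 `exists_level_lipschitz_of_isTestFunctionGL_pair` — the complex combination `η₁ + iη₂` of two
  test functions: one common admissible level (★ `inf_mem_finiteLevelsGL`) and one constant.
* §3 `UnitaryGroup.IsQuasiSplitTest.exists_lift_level_lipschitz` — the `U(J_N)(𝔸_F)` statement
  (every `N`), in the letters of the oscillation row.
* §4 `UnitaryGroup.IsQuasiSplitTest.exists_level_forall_norm_sub_conj_le` — §3 fed into ★
  `UnitaryGroup.forall_norm_sub_conj_le_of_threeFactor`: for a test function `f` and a compact set of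
  directions `S` there are a level `U` and `L ≥ 0` such that, for every `g`, `ρ` and `Ω ⊆ N(𝔸_F)`
  whose conjugates `g⁻¹ Ω g` have the three-factor normal form relative to `(S, U, ρ)`,
  `‖f x − f (x · g⁻¹ u g)‖ ≤ 3 L ρ` — the oscillation bound with ONLY the geometric input left open;
  and the truncated-kernel form `…_norm_truncatedKernel_le`.

## References

* J. D. Rogawski, *Automorphic Representations of Unitary Groups in Three Variables*, Ann. of
  Math. Studies 123 (1990), §2.1–2.2 (pp. 11–13) [Rogawski1990].
* A. Borel, H. Jacquet, *Automorphic forms and automorphic representations*, Proc. Sympos. Pure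
  Math. 33 (1979), Part 1, §1.5, §4.1 [BorelJacquet1979].
* P. Garrett, *Modern Analysis of Automorphic Forms by Example* (2018), §6.3 [Garrett2018].
-/

set_option autoImplicit false

noncomputable section

-- `open scoped Classical` is needed to see the Mathlib (normed ring) instances on `mixedSpace K` (note H5 of
-- `AdelicGLnGlue`)
open scoped MatrixGroups Matrix Classical Topology
open NumberField NumberField.mixedEmbedding IsDedekindDomain Set

namespace Literature.NumberTheory.Automorphic

variable {n : ℕ} {K : Type} [Field K] [NumberField K]

/-! ## §1 The Lipschitz bound along `(exp (tX), 1)` for a smooth kernel -/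

/-- The direction map `X ↦ (j ↦ X) : 𝔤𝔩_n(K_∞) → (Fin 1 → 𝔤)` into one-letter words is continuous,
so it carries compact sets of directions to compact sets of words. [folklore] -/
private theorem isCompact_image_lieOf_const {S : Set (Matrix (Fin n) (Fin n) (mixedSpace K))}
    (hS : IsCompact S) :
    IsCompact ((fun X : Matrix (Fin n) (Fin n) (mixedSpace K) => fun _ : Fin 1 => lieOf X) '' S) :=
  hS.image (continuous_pi fun _ => continuous_id.subtype_mk _)

/-- **Smooth kernels are uniformly Lipschitz along the archimedean one-parameter elements**: for a
smooth kernel `η` on `GL_n(𝔸_K)` (archimedean-smooth, compactly supported, level invariant) and a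
compact set `S ⊆ 𝔤𝔩_n(K_∞)` of directions there is `L ≥ 0` with
`‖η (z · (exp (tX), 1)) − η z‖ ≤ L · |t|` for all `z`, all `X ∈ S` and all `t` (mean value theorem
along `t ↦ exp (tX)`, ★ `IsArchSmooth.norm_sub_le_of_lieDeriv_le`, with the uniform bound of the
Lie derivatives `X η`, `X ∈ S`, ★ `IsSmoothKernelGL.exists_forall_norm_iterLieDeriv_ofFn_le`).
[cite: BorelJacquet1979, §1.5] -/
theorem IsSmoothKernelGL.exists_forall_norm_sub_expGL_le {η : GL (Fin n) (AdeleRing (𝓞 K) K) → ℂ}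
    (hη : IsSmoothKernelGL n K η) {S : Set (Matrix (Fin n) (Fin n) (mixedSpace K))}
    (hS : IsCompact S) :
    ∃ L : ℝ, 0 ≤ L ∧ ∀ z : GL (Fin n) (AdeleRing (𝓞 K) K), ∀ X ∈ S, ∀ t : ℝ,
      ‖η (z * GLn.ofInfinite n K (expGL (t • X))) - η z‖ ≤ L * |t| := by
  obtain ⟨L, hL0, hL⟩ := hη.exists_forall_norm_iterLieDeriv_ofFn_le (isCompact_image_lieOf_const hS)
  refine ⟨L, hL0, fun z X hX t => ?_⟩
  -- the uniform bound on the Lie derivative `X η`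
  have hC : ∀ g, ‖Literature.NumberTheory.Automorphic.lieDeriv (glArch n K) (lieOf X) η g‖ ≤ L := by
    intro g
    have h := hL (fun _ : Fin 1 => lieOf X) ⟨X, hX, rfl⟩ g
    have e : List.ofFn (fun _ : Fin 1 => lieOf X) = [lieOf X] := by simp [List.ofFn_succ]
    rw [e, iterLieDeriv_cons, iterLieDeriv_nil] at h
    exact h
  -- the mean value theorem along `t ↦ exp (tX)`
  have h := hη.isArchSmooth.norm_sub_le_of_lieDeriv_le (glArch n K) (lieOf X) hC z t
  have hexp : glArch n K ((archGroupGL n K).expMem (t • lieOf X)) =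
      GLn.ofInfinite n K (expGL (t • X)) := rfl
  rwa [hexp] at h

/-- **Test functions are uniformly Lipschitz along the archimedean one-parameter elements**
(the real-valued `IsTestFunctionGL` form, read on its complexification ★
`IsTestFunctionGL.isSmoothKernelGL`). [cite: Garrett2018, §6.3] -/
theorem IsTestFunctionGL.exists_forall_norm_sub_expGL_le {η : GL (Fin n) (AdeleRing (𝓞 K) K) → ℝ}
    (hη : IsTestFunctionGL n K η) {S : Set (Matrix (Fin n) (Fin n) (mixedSpace K))}
    (hS : IsCompact S) :
    ∃ L : ℝ, 0 ≤ L ∧ ∀ z : GL (Fin n) (AdeleRing (𝓞 K) K), ∀ X ∈ S, ∀ t : ℝ,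
      ‖(η (z * GLn.ofInfinite n K (expGL (t • X))) : ℂ) - η z‖ ≤ L * |t| :=
  hη.isSmoothKernelGL.exists_forall_norm_sub_expGL_le hS

/-! ## §2 The complex combination `η₁ + iη₂` of two test functions -/

/-- **One level and one Lipschitz constant for `φ = η₁ + iη₂`.** For test functions `η₁, η₂` on
`GL_n(𝔸_K)` and a compact set `S` of directions there are an admissible level `U` (the intersection
of the two levels, ★ `inf_mem_finiteLevelsGL`) under which `φ := η₁ + iη₂` is right invariant and a
constant `L ≥ 0` with `‖φ (z · (exp (tX), 1)) − φ z‖ ≤ L|t|` for all `z`, `X ∈ S`, `t`.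
[cite: BorelJacquet1979, §1.5 and §4.1] -/
theorem exists_level_lipschitz_of_isTestFunctionGL_pair {η₁ η₂ : GL (Fin n) (AdeleRing (𝓞 K) K) → ℝ}
    (hη₁ : IsTestFunctionGL n K η₁) (hη₂ : IsTestFunctionGL n K η₂)
    {S : Set (Matrix (Fin n) (Fin n) (mixedSpace K))} (hS : IsCompact S) :
    ∃ U ∈ finiteLevelsGL n K,
      (∀ u ∈ U, ∀ z : GL (Fin n) (AdeleRing (𝓞 K) K),
        ((η₁ (z * u) : ℝ) : ℂ) + ((η₂ (z * u) : ℝ) : ℂ) * Complex.I = (η₁ z : ℂ) + (η₂ z : ℂ) * Complex.I) ∧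
      ∃ L : ℝ, 0 ≤ L ∧ ∀ z : GL (Fin n) (AdeleRing (𝓞 K) K), ∀ X ∈ S, ∀ t : ℝ,
        ‖((η₁ (z * GLn.ofInfinite n K (expGL (t • X))) : ℂ) +
            (η₂ (z * GLn.ofInfinite n K (expGL (t • X))) : ℂ) * Complex.I) -
          ((η₁ z : ℂ) + (η₂ z : ℂ) * Complex.I)‖ ≤ L * |t| := by
  obtain ⟨U₁, hU₁, hinv₁⟩ := hη₁.exists_level
  obtain ⟨U₂, hU₂, hinv₂⟩ := hη₂.exists_level
  obtain ⟨L₁, hL₁0, hL₁⟩ := hη₁.exists_forall_norm_sub_expGL_le hS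
  obtain ⟨L₂, hL₂0, hL₂⟩ := hη₂.exists_forall_norm_sub_expGL_le hS
  refine ⟨U₁ ⊓ U₂, inf_mem_finiteLevelsGL hU₁ hU₂, fun u hu z => ?_, L₁ + L₂, by positivity,
    fun z X hX t => ?_⟩
  · rw [hinv₁ u (Subgroup.mem_inf.1 hu).1 z, hinv₂ u (Subgroup.mem_inf.1 hu).2 z]
  · have h₁ := hL₁ z X hX t
    have h₂ := hL₂ z X hX t
    -- `‖(a + bI) − (a′ + b′I)‖ ≤ ‖a − a′‖ + ‖b − b′‖`
    have key : ∀ a a' b b' : ℂ, ‖(a + b * Complex.I) - (a' + b' * Complex.I)‖ ≤ ‖a - a'‖ + ‖b - b'‖ := by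
      intro a a' b b'
      have e : (a + b * Complex.I) - (a' + b' * Complex.I) = (a - a') + (b - b') * Complex.I := by ring
      rw [e]
      refine (norm_add_le _ _).trans ?_
      rw [norm_mul, Complex.norm_I, mul_one]
    refine (key _ _ _ _).trans ?_
    calc ‖(η₁ (z * GLn.ofInfinite n K (expGL (t • X))) : ℂ) - η₁ z‖ +
          ‖(η₂ (z * GLn.ofInfinite n K (expGL (t • X))) : ℂ) - η₂ z‖
        ≤ L₁ * |t| + L₂ * |t| := add_le_add h₁ h₂
      _ = (L₁ + L₂) * |t| := by ring

/-! ## §3 The `U(J_N)(𝔸_F)` statement -/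

namespace UnitaryGroup

variable {F E : Type} [Field F] [NumberField F] [Field E] [NumberField E] [Algebra F E]
  {c : E ≃ₐ[F] E} {N : ℕ}

/-- **A TEST FUNCTION ON `U(J_N)(𝔸_F)` LIFTS TO A LEVEL-INVARIANT, ARCHIMEDEAN-LIPSCHITZ FUNCTION
ON `GL_N(𝔸_E)`**: for `f ∈ C_c^∞(U(J_N)(𝔸_F))` (`IsQuasiSplitTest`) and a compact set
`S ⊆ 𝔤𝔩_N(E_∞)` of directions there are `φ : GL_N(𝔸_E) → ℂ` with `f = φ ∘ adelicVal`, an admissible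
level `U ∈ finiteLevelsGL N E` under which `φ` is right invariant, and `L ≥ 0` with
`‖φ (z · (exp (tX), 1)) − φ z‖ ≤ L · |t|` for all `z ∈ GL_N(𝔸_E)`, `X ∈ S`, `t ∈ ℝ` — the input
H5c of the oscillation estimate for the truncated kernel. [cite: Rogawski1990, §2.1–2.2 (pp. 11–13)] -/
theorem IsQuasiSplitTest.exists_lift_level_lipschitz {f : (quasiSplit F E c N).Adelic → ℂ}
    (hf : IsQuasiSplitTest F E c N f) {S : Set (Matrix (Fin N) (Fin N) (mixedSpace E))}
    (hS : IsCompact S) :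
    ∃ φ : GL (Fin N) (AdeleRing (𝓞 E) E) → ℂ,
      (∀ y : (quasiSplit F E c N).Adelic, f y = φ (adelicVal F E c N _ y)) ∧
      ∃ U ∈ finiteLevelsGL N E, (∀ u ∈ U, ∀ z, φ (z * u) = φ z) ∧
        ∃ L : ℝ, 0 ≤ L ∧ ∀ z : GL (Fin N) (AdeleRing (𝓞 E) E), ∀ X ∈ S, ∀ t : ℝ,
          ‖φ (z * GLn.ofInfinite N E (expGL (t • X))) - φ z‖ ≤ L * |t| := by
  obtain ⟨η₁, η₂, hη₁, hη₂, hf⟩ := hf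
  obtain ⟨U, hU, hinv, L, hL0, hL⟩ := exists_level_lipschitz_of_isTestFunctionGL_pair hη₁ hη₂ hS
  exact ⟨fun z => (η₁ z : ℂ) + (η₂ z : ℂ) * Complex.I, hf, U, hU, hinv, L, hL0, hL⟩

/-! ## §4 The oscillation bound with only the geometric input left open -/

/-- **THE OSCILLATION BOUND FOR A TEST FUNCTION, modulo the three-factor geometry.** For
`f ∈ C_c^∞(U(J₃)(𝔸_F))` and a compact set `S ⊆ 𝔤𝔩₃(E_∞)` of directions there are an admissible
level `U ∈ finiteLevelsGL 3 E` and `L ≥ 0` such that for every `g`, every `ρ` and every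
`Ω ⊆ N(𝔸_F)` whose conjugates read `adelicVal (g⁻¹ u g) = (exp (t₁X₁) exp (t₂X₂) exp (t₃X₃), 1) · w`
(`Xᵢ ∈ S`, `|tᵢ| ≤ ρ`, `w ∈ U`) one has `‖f x − f (x · g⁻¹ u g)‖ ≤ 3 · L · ρ` for all `x` and all
`u ∈ Ω` (§3 + ★ `forall_norm_sub_conj_le_of_threeFactor`). [cite: Rogawski1990, §2.2 (p. 13)] -/
theorem IsQuasiSplitTest.exists_level_forall_norm_sub_conj_le {f : (quasiSplit F E c 3).Adelic → ℂ}
    (hf : IsQuasiSplitTest F E c 3 f) {S : Set (Matrix (Fin 3) (Fin 3) (mixedSpace E))}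
    (hS : IsCompact S) :
    ∃ U ∈ finiteLevelsGL 3 E, ∃ L : ℝ, 0 ≤ L ∧
      ∀ (g : (quasiSplit F E c 3).Adelic) (ρ : ℝ) (Ω : Set (adelicUnipotent F E c 3)),
        (∀ u ∈ Ω, ∃ (t₁ t₂ t₃ : ℝ) (X₁ X₂ X₃ : Matrix (Fin 3) (Fin 3) (mixedSpace E))
            (w : GL (Fin 3) (AdeleRing (𝓞 E) E)),
          X₁ ∈ S ∧ X₂ ∈ S ∧ X₃ ∈ S ∧ w ∈ U ∧ |t₁| ≤ ρ ∧ |t₂| ≤ ρ ∧ |t₃| ≤ ρ ∧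
          adelicVal F E c 3 _ (g⁻¹ * (u : (quasiSplit F E c 3).Adelic) * g) =
            GLn.ofInfinite 3 E (expGL (t₁ • X₁) * expGL (t₂ • X₂) * expGL (t₃ • X₃)) * w) →
        ∀ x : (quasiSplit F E c 3).Adelic, ∀ u ∈ Ω,
          ‖f x - f (x * (g⁻¹ * (u : (quasiSplit F E c 3).Adelic) * g))‖ ≤ 3 * L * ρ := by
  obtain ⟨φ, hφ, U, hU, hinv, L, hL0, hL⟩ := hf.exists_lift_level_lipschitz hS
  exact ⟨U, hU, L, hL0, fun g ρ Ω hgeom =>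
    forall_norm_sub_conj_le_of_threeFactor hφ hinv hL0 hL hgeom⟩

variable [MeasurableSpace (adelicUnipotent F E c 3)] [BorelSpace (adelicUnipotent F E c 3)] in
/-- **THE TRUNCATED KERNEL OF A TEST FUNCTION IS SMALL HIGH IN THE CUSP, modulo the three-factor
geometry**: `‖k^T(g)‖ ≤ #R(g) · (3 · L · ρ)` in the packaged form of ★
`exists_finset_norm_truncatedKernel_le_of_threeFactor`, with `U`, `L` depending only on `f` and the
compact set of directions `S` (continuity and compact support of `f` are ★
`IsQuasiSplitTest.continuous'`, `IsQuasiSplitTest.hasCompactSupport'`). [cite: Rogawski1990, §2.2 (p. 13)] -/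
theorem IsQuasiSplitTest.exists_level_norm_truncatedKernel_le {f : (quasiSplit F E c 3).Adelic → ℂ}
    (hf : IsQuasiSplitTest F E c 3 f)
    {S : Set (Matrix (Fin 3) (Fin 3) (mixedSpace E))} (hS : IsCompact S) :
    ∃ U ∈ finiteLevelsGL 3 E, ∃ L : ℝ, 0 ≤ L ∧
      ∀ (ν : MeasureTheory.Measure (adelicUnipotent F E c 3)) [ν.IsHaarMeasure]
        {𝓕 Uc : Set (adelicUnipotent F E c 3)},
        MeasureTheory.IsFundamentalDomain (rationalUnipotent F E c 3) 𝓕 ν → IsCompact Uc → 𝓕 ⊆ Uc →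
        ∀ {T : NNReal}, 1 ≤ T → ∀ {g : (quasiSplit F E c 3).Adelic}, T < borelHeight g →
        kernel f g g = borelSum f g g → ∀ (ρ : ℝ),
        (∀ u ∈ 𝓕, ∃ (t₁ t₂ t₃ : ℝ) (X₁ X₂ X₃ : Matrix (Fin 3) (Fin 3) (mixedSpace E))
            (w : GL (Fin 3) (AdeleRing (𝓞 E) E)),
          X₁ ∈ S ∧ X₂ ∈ S ∧ X₃ ∈ S ∧ w ∈ U ∧ |t₁| ≤ ρ ∧ |t₂| ≤ ρ ∧ |t₃| ≤ ρ ∧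
          adelicVal F E c 3 _ (g⁻¹ * (u : (quasiSplit F E c 3).Adelic) * g) =
            GLn.ofInfinite 3 E (expGL (t₁ • X₁) * expGL (t₂ • X₂) * expGL (t₃ • X₃)) * w) →
        ∃ R : Finset (arithmeticBorel F E c 3),
          (∀ β ∈ R, ∃ y ∈ insert (1 : (quasiSplit F E c 3).Adelic)
              ((fun u : adelicUnipotent F E c 3 => (u : (quasiSplit F E c 3).Adelic)) '' Uc),
            g⁻¹ * (((β : (quasiSplit F E c 3).arithmeticSubgroup)) : (quasiSplit F E c 3).Adelic) *
              (y * g) ∈ tsupport f) ∧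
          ‖truncatedKernel ν 𝓕 T f g‖ ≤ R.card * (3 * L * ρ) := by
  obtain ⟨φ, hφ, U, hU, hinv, L, hL0, hL⟩ := hf.exists_lift_level_lipschitz hS
  exact ⟨U, hU, L, hL0, fun ν _ 𝓕 Uc h𝓕 hUc h𝓕U T hT g hg hK ρ hgeom =>
    exists_finset_norm_truncatedKernel_le_of_threeFactor ν h𝓕 hUc h𝓕U hf.continuous' hf.hasCompactSupport'
      hT hg hK hφ hinv hL0 hL hgeom⟩

end UnitaryGroup

end Literature.NumberTheory.Automorphic

end
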